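import Literature.AnabelianGeometry.SemiGraphs.TemperedVerticialInjective
import Literature.AnabelianGeometry.SemiGraphs.TemperoidsHomTorsor
import Mathlib.GroupTheory.Index
import HarnessLib

/-!
# [SemiAnbd] Prop. 2.5 (i) in `B^cov` currency: a quasi-coherent semi-graph of anabelioids has FINITE coverings with
# prescribed-small stabilisers (Def. 2.3 (iii) p. 25; Prop. 2.5 (i) p. 27; proof of Prop. 4.4 (i) p. 55 first reduction)

Mochizuki, *Semi-graphs of anabelioids*, Publ. RIMS **42** (2006), §2: Def. 2.3 (iii) p. 25 (quasi-coherent: "for every integer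
`M ≥ 1`, and every collection of finite étale coverings `H_c → G_c` of degree `≤ M` … there exists an approximator `G → G'` such
that … the pull-back to `G_c` of the 'universal covering' `H'_c → G'_c` … splits `H_c → G_c`"), Prop. 2.5 (i) p. 27 and its proof
("a finite étale covering of `G` each of whose constituent anabelioids is trivial [over `G'`]"), §4 proof of Prop. 4.4 (i) p. 55
("Since `K` is quasi-coherent, it follows from Proposition 2.5, (i), that we may reduce immediately to the case where the given
morphism `H → K` is locally trivial") [cite: MochizukiSemiAnbd2006, Prop 2.5 p.27] [cite: MochizukiSemiAnbd2006, Def 2.3(iii) p.25].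

PROOF-ONLY file (abc-iut cell, layer L3 [SemiAnbd], block-F seat abc-iut-f-169 gen 4; L3-lead row «PROP25i-COVOBJ-SMALLSTAB»
keyed δ64, GO δ65; SHAPES e709aa3e5032b95a; 0 `def` · 0 `instance` · 0 notation · 0 `Prop` fact · 0 `sorry`).  CONSUMER:
abc-iut-f-161 gen 8's `CoveringGraphPullbackSquareSmallStab` (`Hom.covPullbackSnd_isLocallyTrivial_of_stab_le`), whose displayed
hypotheses `hV`/`hE` — a covering of `K` with point stabilisers over the image of `ψ : H → K` inside the ranges of the constituents
of `ψ` — are produced here (`Hom.exists_finite_covObj_stab_le_range`).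

## What is proved (ProfiniteSemiGraph / `B^cov` presentation; no `B(G)` bridge)

The printed proof of Prop. 2.5 (i) is ALREADY a construction in the tree: abc-iut-L3's trivialising covering
`Approximator.trivCov` (`TemperedVerticialInjective.lean`: over `v` the finite `Π_v`-set `F_v × Fin m`, `Π_v` acting through
`π_v : Π_v → F_v` by left multiplication; finite, nonempty fibres, tempered).  This file only reads off its stabilisers and feeds
the tree's `IsQuasiCoherent` (Def. 2.3 (iii) verbatim) with coset spaces:

* §1 `Approximator.trivCov_ρV_eq_iff` / `_ρE_eq_iff` — a point of `trivCov` is fixed by `k` iff `π_v k = 1` (resp. `π_e k = 1`):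
  the stabilisers are EXACTLY the kernels of the approximator;
* §2 `exists_approximator_ker_le_of_isQuasiCoherent` — for open subgroups `U_v ≤ Π_v`, `U_e ≤ Π_e` of uniformly bounded index
  `≤ M`, quasi-coherence applied to the finite coset spaces `Π_v/U_v`, `Π_e/U_e` (`BTemp.quotientObj`, Rmk. 3.1.1
  `IsTempered.of_profinite`) yields an approximator with `ker π_v ≤ U_v`, `ker π_e ≤ U_e`;
* §3 ★ `exists_finite_covObj_stab_le_of_isQuasiCoherent` — **Prop. 2.5 (i), covering form**: `K` quasi-coherent, `U_v`, `U_e` open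
  of index `≤ M` ⟹ a FINITE, TEMPERED covering `S ∈ B^cov(K)` with NONEMPTY fibres all of whose point stabilisers satisfy
  `Stab_{Π_v}(t) ≤ U_v`, `Stab_{Π_e}(t) ≤ U_e`; `…_of_finite` — the same for open subgroups prescribed on FINITE sets of vertices and
  edges (no bound to supply);
* §4 ★ `Hom.exists_finite_covObj_stab_le_range` — the consumer form: for a locally open `ψ : H → K` with `H` finite and `K`
  quasi-coherent, a finite tempered covering of `K` with nonempty fibres whose point stabilisers over `ψ w` / `ψ e′` lie in
  `ψ_w(Π_{H,w})` / `ψ_{e′}(Π_{H,e′})` for EVERY `w`, `e′` (take `U_v := ⨅_{w ↦ v} ψ_w(Π_{H,w})`, a finite intersection of open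
  subgroups, index `≤ ∏_w [Π_{K,ψ w} : ψ_w(Π_{H,w})]` by `Subgroup.index_iInf_le`).

Binder census: structural data + `IsQuasiCoherent K` (Def. 2.3 (iii), the proposition's own hypothesis) + openness / finiteness /
local openness as displayed; FACT 0 · GAP 0 · smuggled 0.  Honest framing: a theorem about the tree's OWN typing of
quasi-coherence and coverings (the approximator IS print's `G'`, `trivCov` IS print's "union of copies of the universal covering
of `G'_c`"); print's Prop. 2.5 (i) proper («`π₁(G_v) → π₁(G)` injective») is abc-iut-w4-d063's `piHToPi_injective` and is not
restated; typed ≠ proved for anything else; nothing here takes a side on [IUTchIII] Cor. 3.12; nothing asserts that abc is proved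
or refuted.
-/

namespace Literature.AnabelianGeometry.SemiGraphs

namespace ProfiniteSemiGraph

open CategoryTheory Topology

universe u

variable {K : ProfiniteSemiGraph.{u}}

/-! ### 1. Stabilisers of the trivialising covering are the kernels of the approximator -/

namespace Approximator

variable (A : K.Approximator) {M : ℕ} (hM : 0 < M) (hdvd : ∀ w, Nat.card (A.FV w) ∣ M)

/-- A point of the `v`-constituent of `trivCov` is fixed by `k ∈ Π_v` iff `π_v k = 1` (the action is left multiplication through
`π_v` on `F_v × Fin m`). [cite: MochizukiSemiAnbd2006, Prop 2.5 p.27] -/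
theorem trivCov_ρV_eq_iff (w : K.graph.Vertex) (k : K.Gv w) (t : ((A.trivCov hM hdvd).SV w).obj.V) :
    ((A.trivCov hM hdvd).SV w).obj.ρ k t = t ↔ A.πV w k = 1 := by
  change (A.πV w k * t.1, t.2) = t ↔ _
  rw [Prod.ext_iff, and_iff_left rfl]
  exact mul_eq_right

/-- The edge analogue: a point of the `e`-constituent of `trivCov` is fixed by `k ∈ Π_e` iff `π_e k = 1`.
[cite: MochizukiSemiAnbd2006, Prop 2.5 p.27] -/
theorem trivCov_ρE_eq_iff (e : K.graph.Edge) (k : K.Ge e) (t : ((A.trivCov hM hdvd).SE e).obj.V) :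
    ((A.trivCov hM hdvd).SE e).obj.ρ k t = t ↔ A.πE e k = 1 := by
  change (A.πE e k * t.1, t.2) = t ↔ _
  rw [Prod.ext_iff, and_iff_left rfl]
  exact mul_eq_right

end Approximator

/-! ### 2. Quasi-coherence hands out an approximator with kernels inside prescribed open subgroups -/

/-- **Def. 2.3 (iii) applied to coset spaces.**  If `K` is quasi-coherent and `U_v ≤ Π_v`, `U_e ≤ Π_e` are open subgroups of
index `≤ M` at every vertex and edge, there is an approximator `K → K'` with `ker(Π_v → Π'_v) ≤ U_v` and `ker(Π_e → Π'_e) ≤ U_e`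
(the kernels act trivially on the finite coverings `Π_v/U_v`, in particular fix the base coset).
[cite: MochizukiSemiAnbd2006, Def 2.3(iii) p.25] -/
theorem exists_approximator_ker_le_of_isQuasiCoherent (hqc : K.IsQuasiCoherent)
    (U : ∀ v : K.graph.Vertex, Subgroup (K.Gv v)) (hUo : ∀ v, IsOpen (U v : Set (K.Gv v)))
    (UE : ∀ e : K.graph.Edge, Subgroup (K.Ge e)) (hUEo : ∀ e, IsOpen (UE e : Set (K.Ge e)))
    (M : ℕ) (hMV : ∀ v, (U v).index ≤ M) (hME : ∀ e, (UE e).index ≤ M) :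
    ∃ A : K.Approximator, (∀ (v : K.graph.Vertex) (k : K.Gv v), A.πV v k = 1 → k ∈ U v) ∧
      ∀ (e : K.graph.Edge) (k : K.Ge e), A.πE e k = 1 → k ∈ UE e := by
  -- the finite coset spaces `Π_v/U_v`, `Π_e/U_e` as objects of `B^temp(Π_v)`, `B^temp(Π_e)`
  let HV : ∀ v : K.graph.Vertex, BTemp (K.Gv v) := fun v =>
    BTemp.quotientObj (K.Gv v) IsTempered.of_profinite (U v) (hUo v)
  let HE : ∀ e : K.graph.Edge, BTemp (K.Ge e) := fun e =>
    BTemp.quotientObj (K.Ge e) IsTempered.of_profinite (UE e) (hUEo e)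
  have hcardV : ∀ v, Nat.card (HV v).obj.V ≤ M ∧ Finite (HV v).obj.V := fun v =>
    ⟨(hMV v : (U v).index ≤ M), (Subgroup.quotient_finite_of_isOpen (U v) (hUo v) : Finite (K.Gv v ⧸ U v))⟩
  have hcardE : ∀ e, Nat.card (HE e).obj.V ≤ M ∧ Finite (HE e).obj.V := fun e =>
    ⟨(hME e : (UE e).index ≤ M), (Subgroup.quotient_finite_of_isOpen (UE e) (hUEo e) : Finite (K.Ge e ⧸ UE e))⟩
  obtain ⟨A, hAV, hAE⟩ := hqc M HV HE hcardV hcardE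
  refine ⟨A, fun v k hk => ?_, fun e k hk => ?_⟩
  · have h1 := hAV v k hk ((1 : K.Gv v) : K.Gv v ⧸ U v)
    change (BTemp.quotientObj (K.Gv v) IsTempered.of_profinite (U v) (hUo v)).obj.ρ k
      ((1 : K.Gv v) : K.Gv v ⧸ U v) = ((1 : K.Gv v) : K.Gv v ⧸ U v) at h1
    rw [BTemp.quotientObj_ρ_apply, mul_one] at h1
    have h2 : ((k : K.Gv v) : K.Gv v ⧸ U v) = ((1 : K.Gv v) : K.Gv v ⧸ U v) := h1
    rw [QuotientGroup.eq, mul_one, inv_mem_iff] at h2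
    exact h2
  · have h1 := hAE e k hk ((1 : K.Ge e) : K.Ge e ⧸ UE e)
    change (BTemp.quotientObj (K.Ge e) IsTempered.of_profinite (UE e) (hUEo e)).obj.ρ k
      ((1 : K.Ge e) : K.Ge e ⧸ UE e) = ((1 : K.Ge e) : K.Ge e ⧸ UE e) at h1
    rw [BTemp.quotientObj_ρ_apply, mul_one] at h1
    have h2 : ((k : K.Ge e) : K.Ge e ⧸ UE e) = ((1 : K.Ge e) : K.Ge e ⧸ UE e) := h1
    rw [QuotientGroup.eq, mul_one, inv_mem_iff] at h2
    exact h2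

/-! ### 3. Prop. 2.5 (i), covering form: finite coverings with prescribed-small stabilisers -/

/-- **[SemiAnbd] Prop. 2.5 (i) in `B^cov` currency.**  Let `K` be quasi-coherent and let `U_v ≤ Π_v`, `U_e ≤ Π_e` be open subgroups
of uniformly bounded index (Def. 2.3 (iii)'s «degree `≤ M`»; e.g. `⊤` off finitely many vertices and edges).  Then there is a
FINITE, TEMPERED covering `S ∈ B^cov(K)` with NONEMPTY fibres all of whose point stabilisers are small: `Stab_{Π_v}(t) ≤ U_v` and
`Stab_{Π_e}(t) ≤ U_e` for every vertex `v`, edge `e` and point `t` — namely the trivialising covering of the approximator supplied by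
quasi-coherence ("a finite étale covering of `G` each of whose constituent anabelioids is trivial [over `G'`]", proof of Prop. 2.5 (i)
p. 27), whose stabilisers are the kernels `ker(Π_c → Π'_c)`. [cite: MochizukiSemiAnbd2006, Prop 2.5 p.27] -/
theorem exists_finite_covObj_stab_le_of_isQuasiCoherent (hqc : K.IsQuasiCoherent)
    (U : ∀ v : K.graph.Vertex, Subgroup (K.Gv v)) (hUo : ∀ v, IsOpen (U v : Set (K.Gv v)))
    (UE : ∀ e : K.graph.Edge, Subgroup (K.Ge e)) (hUEo : ∀ e, IsOpen (UE e : Set (K.Ge e)))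
    (M : ℕ) (hMV : ∀ v, (U v).index ≤ M) (hME : ∀ e, (UE e).index ≤ M) :
    ∃ S : CovObj K, S.IsFinite ∧ S.HasNonemptyFibres ∧ S.IsTempered ∧
      (∀ (v : K.graph.Vertex) (t : (S.SV v).obj.V) (k : K.Gv v), (S.SV v).obj.ρ k t = t → k ∈ U v) ∧
      ∀ (e : K.graph.Edge) (t : (S.SE e).obj.V) (k : K.Ge e), (S.SE e).obj.ρ k t = t → k ∈ UE e := by
  obtain ⟨A, hAV, hAE⟩ := exists_approximator_ker_le_of_isQuasiCoherent hqc U hUo UE hUEo M hMV hME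
  obtain ⟨M', hM', hdvd⟩ := A.bounded
  exact ⟨A.trivCov hM' hdvd, A.trivCov_isFinite hM' hdvd, A.trivCov_hasNonemptyFibres hM' hdvd,
    A.trivCov_isTempered hM' hdvd,
    fun v t k hk => hAV v k ((A.trivCov_ρV_eq_iff hM' hdvd v k t).mp hk),
    fun e t k hk => hAE e k ((A.trivCov_ρE_eq_iff hM' hdvd e k t).mp hk)⟩

/-- **Prop. 2.5 (i), covering form, for open subgroups prescribed on FINITE sets of vertices and edges** (no index bound to
supply: outside the finite sets one uses `⊤`, and finitely many indices are bounded).  [cite: MochizukiSemiAnbd2006, Prop 2.5 p.27] -/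
theorem exists_finite_covObj_stab_le_of_finite (hqc : K.IsQuasiCoherent)
    (W : Finset K.graph.Vertex) (U : ∀ v : K.graph.Vertex, Subgroup (K.Gv v))
    (hUo : ∀ v ∈ W, IsOpen (U v : Set (K.Gv v)))
    (D : Finset K.graph.Edge) (UE : ∀ e : K.graph.Edge, Subgroup (K.Ge e))
    (hUEo : ∀ e ∈ D, IsOpen (UE e : Set (K.Ge e))) :
    ∃ S : CovObj K, S.IsFinite ∧ S.HasNonemptyFibres ∧ S.IsTempered ∧
      (∀ v ∈ W, ∀ (t : (S.SV v).obj.V) (k : K.Gv v), (S.SV v).obj.ρ k t = t → k ∈ U v) ∧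
      ∀ e ∈ D, ∀ (t : (S.SE e).obj.V) (k : K.Ge e), (S.SE e).obj.ρ k t = t → k ∈ UE e := by
  classical
  -- enlarge to `⊤` off the finite sets
  let U' : ∀ v : K.graph.Vertex, Subgroup (K.Gv v) := fun v => if v ∈ W then U v else ⊤
  let UE' : ∀ e : K.graph.Edge, Subgroup (K.Ge e) := fun e => if e ∈ D then UE e else ⊤
  have hU'o : ∀ v, IsOpen (U' v : Set (K.Gv v)) := fun v => by
    by_cases hv : v ∈ W
    · simp only [U', hv, if_true]; exact hUo v hv
    · simp only [U', hv, if_false]; exact isOpen_univ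
  have hUE'o : ∀ e, IsOpen (UE' e : Set (K.Ge e)) := fun e => by
    by_cases he : e ∈ D
    · simp only [UE', he, if_true]; exact hUEo e he
    · simp only [UE', he, if_false]; exact isOpen_univ
  -- a uniform bound on the indices
  let M : ℕ := W.sup (fun v => (U v).index) ⊔ D.sup (fun e => (UE e).index) ⊔ 1
  have hMV : ∀ v, (U' v).index ≤ M := fun v => by
    by_cases hv : v ∈ W
    · simp only [U', hv, if_true]
      exact le_sup_of_le_left (le_sup_of_le_left (Finset.le_sup (f := fun v => (U v).index) hv))
    · simp only [U', hv, if_false, Subgroup.index_top]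
      exact le_sup_right
  have hME : ∀ e, (UE' e).index ≤ M := fun e => by
    by_cases he : e ∈ D
    · simp only [UE', he, if_true]
      exact le_sup_of_le_left (le_sup_of_le_right (Finset.le_sup (f := fun e => (UE e).index) he))
    · simp only [UE', he, if_false, Subgroup.index_top]
      exact le_sup_right
  obtain ⟨S, hSf, hSn, hSt, hSV, hSE⟩ :=
    exists_finite_covObj_stab_le_of_isQuasiCoherent hqc U' hU'o UE' hUE'o M hMV hME
  refine ⟨S, hSf, hSn, hSt, fun v hv t k hk => ?_, fun e he t k hk => ?_⟩
  · have := hSV v t k hk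
    simp only [U', hv, if_true] at this
    exact this
  · have := hSE e t k hk
    simp only [UE', he, if_true] at this
    exact this

/-! ### 4. The consumer form: small stabilisers on the image of a locally open morphism with finite source -/

namespace Hom

variable {H : ProfiniteSemiGraph.{u}} (ψ : Hom H K)

/-- **Prop. 2.5 (i) as used in the proof of Prop. 4.4 (i) (p. 55, "we may reduce immediately to the case where the given morphism
`H → K` is locally trivial").**  For a locally open `ψ : H → K` with `H` FINITE and `K` quasi-coherent there is a finite tempered
covering `S ∈ B^cov(K)` with nonempty fibres whose point stabilisers over the image of `ψ` are SMALL: every `k ∈ Π_{K,ψ w}` fixing a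
point of `S_{ψ w}` lies in `ψ_w(Π_{H,w})`, for EVERY vertex `w` of `H` (and likewise for edges) — exactly the hypotheses `hV`/`hE` of
abc-iut-f-161's `covPullbackSnd_isLocallyTrivial_of_stab_le`.  (Take `U_v := ⨅_{w ↦ v} ψ_w(Π_{H,w})`, a finite intersection of open
subgroups.) [cite: MochizukiSemiAnbd2006, Prop 4.4 p.54] -/
theorem exists_finite_covObj_stab_le_range [Finite H.graph.Vertex] [Finite H.graph.Edge]
    (hqc : K.IsQuasiCoherent) (hψ : ψ.IsLocallyOpen) :
    ∃ S : CovObj K, S.IsFinite ∧ S.HasNonemptyFibres ∧ S.IsTempered ∧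
      (∀ (w : H.graph.Vertex) (t : (S.SV (ψ.base.vertexMap w)).obj.V) (k : K.Gv (ψ.base.vertexMap w)),
        (S.SV _).obj.ρ k t = t → ∃ m : H.Gv w, ψ.hV w m = k) ∧
      ∀ (e' : H.graph.Edge) (t : (S.SE (ψ.base.edgeMap e')).obj.V) (k : K.Ge (ψ.base.edgeMap e')),
        (S.SE _).obj.ρ k t = t → ∃ m : H.Ge e', ψ.hE e' m = k := by
  classical
  haveI : Fintype H.graph.Vertex := Fintype.ofFinite _
  haveI : Fintype H.graph.Edge := Fintype.ofFinite _
  -- `U_v := ⨅_{w ↦ v} range ψ_w` (factors `⊤` at the `w` not over `v`)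
  let fV : ∀ (v : K.graph.Vertex) (w : H.graph.Vertex), Subgroup (K.Gv v) := fun v w =>
    if h : ψ.base.vertexMap w = v then h ▸ (ψ.hV w).toMonoidHom.range else ⊤
  let fE : ∀ (e : K.graph.Edge) (e' : H.graph.Edge), Subgroup (K.Ge e) := fun e e' =>
    if h : ψ.base.edgeMap e' = e then h ▸ (ψ.hE e').toMonoidHom.range else ⊤
  let U : ∀ v : K.graph.Vertex, Subgroup (K.Gv v) := fun v => ⨅ w, fV v w
  let UE : ∀ e : K.graph.Edge, Subgroup (K.Ge e) := fun e => ⨅ e', fE e e'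
  have hfVo : ∀ v w, IsOpen (fV v w : Set (K.Gv v)) := fun v w => by
    by_cases h : ψ.base.vertexMap w = v
    · subst h; simp only [fV, dif_pos]; exact hψ.1 w
    · simp only [fV, h, dif_neg, not_false_eq_true]; exact isOpen_univ
  have hfEo : ∀ e e', IsOpen (fE e e' : Set (K.Ge e)) := fun e e' => by
    by_cases h : ψ.base.edgeMap e' = e
    · subst h; simp only [fE, dif_pos]; exact hψ.2 e'
    · simp only [fE, h, dif_neg, not_false_eq_true]; exact isOpen_univ
  have hUo : ∀ v, IsOpen (U v : Set (K.Gv v)) := fun v => by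
    change IsOpen ((⨅ w, fV v w : Subgroup (K.Gv v)) : Set (K.Gv v))
    rw [Subgroup.coe_iInf]
    exact isOpen_iInter_of_finite fun w => hfVo v w
  have hUEo : ∀ e, IsOpen (UE e : Set (K.Ge e)) := fun e => by
    change IsOpen ((⨅ e', fE e e' : Subgroup (K.Ge e)) : Set (K.Ge e))
    rw [Subgroup.coe_iInf]
    exact isOpen_iInter_of_finite fun e' => hfEo e e'
  -- uniform index bounds: each factor has index `≤ index(range ψ_w) + 1`
  let MV : ℕ := ∏ w : H.graph.Vertex, ((ψ.hV w).toMonoidHom.range.index + 1)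
  let ME : ℕ := ∏ e' : H.graph.Edge, ((ψ.hE e').toMonoidHom.range.index + 1)
  have hfV_index : ∀ v w, (fV v w).index ≤ (ψ.hV w).toMonoidHom.range.index + 1 := fun v w => by
    by_cases h : ψ.base.vertexMap w = v
    · subst h; simp only [fV, dif_pos]; exact Nat.le_succ _
    · simp only [fV, h, dif_neg, not_false_eq_true, Subgroup.index_top]; exact Nat.le_add_left 1 _
  have hfE_index : ∀ e e', (fE e e').index ≤ (ψ.hE e').toMonoidHom.range.index + 1 := fun e e' => by
    by_cases h : ψ.base.edgeMap e' = e
    · subst h; simp only [fE, dif_pos]; exact Nat.le_succ _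
    · simp only [fE, h, dif_neg, not_false_eq_true, Subgroup.index_top]; exact Nat.le_add_left 1 _
  have hMV : ∀ v, (U v).index ≤ MV ⊔ ME := fun v =>
    ((Subgroup.index_iInf_le (fV v)).trans (Finset.prod_le_prod (fun w _ => Nat.zero_le _)
      fun w _ => hfV_index v w)).trans le_sup_left
  have hME : ∀ e, (UE e).index ≤ MV ⊔ ME := fun e =>
    ((Subgroup.index_iInf_le (fE e)).trans (Finset.prod_le_prod (fun e' _ => Nat.zero_le _)
      fun e' _ => hfE_index e e')).trans le_sup_right
  obtain ⟨S, hSf, hSn, hSt, hSV, hSE⟩ :=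
    exists_finite_covObj_stab_le_of_isQuasiCoherent hqc U hUo UE hUEo (MV ⊔ ME) hMV hME
  refine ⟨S, hSf, hSn, hSt, fun w t k hk => ?_, fun e' t k hk => ?_⟩
  · have hkU : k ∈ fV (ψ.base.vertexMap w) w := Subgroup.mem_iInf.mp (hSV _ t k hk) w
    simp only [fV, dif_pos] at hkU
    exact MonoidHom.mem_range.mp hkU
  · have hkU : k ∈ fE (ψ.base.edgeMap e') e' := Subgroup.mem_iInf.mp (hSE _ t k hk) e'
    simp only [fE, dif_pos] at hkU
    exact MonoidHom.mem_range.mp hkU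

end Hom

end ProfiniteSemiGraph

end Literature.AnabelianGeometry.SemiGraphs
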